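import Summits.BirchSwinnertonDyer.BirchSwinnertonDyer.Theorems.ByReductionTypeAtTwoMultTransportTwistedDescentLocalHelpers
import HarnessLib

/-!
# T-42-mult in the kernel, XXIV-b′: the orthogonality ENGINE, ALTERNATING-pairing form (the local hypotheses
# `δ2`, `δinf` quantify over ALTERNATING Weil pairings only — `halt : e T T = 1`, as provided by `exists_weilPairing`) — targets of level `j'` pushed to `J = j' + a + 2b`
# are orthogonal to `H¹_{𝓕^*}(ℚ, E[2^J](χ_u)^D)` (one `u`, one class `c`)

Cell `bsd-2adic` (run/shared/lean/pub/bsd-2adic/), seat `bsd-2adic-t42` (BRIEF-T42), GEN 16. HONEST FRAMING: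
research route; THEOREMS ONLY (no `def`, no named fact, no instance); nothing booked; nothing re-keyed
(RC-169); BSD is not proved by any of this. PARTITION: X5@2 multiplicative GV-transport rows (K4ᵐ B1·O1; the
residual `LIFT₃` of `hF3b`) × p = 2 — types-the-object-of; bears_on K4 items 19922 / 19923
(`--supports stmt-BirchSwinnertonDyer-19923`). Bricks (β1)+(β2)+(ζ) of HOME/t42/DESIGN-T42-ADDENDUM-17.md for ONE
`(u, c)`: `exists_target_orthogonal_alt` — identical to XXIV-b `exists_target_orthogonal` except that the two local
hypotheses carry the extra binder `halt` (so that they are statements about Weil pairings proper: a Galois-equivariant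
non-degenerate SYMMETRIC `μ`-valued pairing on `E[2]` with trivial action would make the annihilator statements false;
the engine's own pairing comes from `exists_weilPairing_holds`, which is alternating). Given `2^a` killing the `u`-eigenvectors of `conj_γ` in `Sel_∞`, `2^b`
killing `E(ℚ_∞)[2^∞]`, `2^f` killing the twisted eigenvectors at an omitted prime `v₀`, the two local dual
Kummer statements `δ2`, `δinf` and the local targets of `T2` at `2`: take targets `t'` at level
`j' = max(J_T, ord c, f, 1)` (pushed up by `ι`; at `∞` by `exists_twistedTorsionToLocalH1_eq_localResOver_infinitePlace`),
`J = j' + a + 2b`, `t = H¹(ι) t'`; for `y ∈ H¹_{𝓕^*}(ℚ, E[2^J](χ_u)^D)`: `y = H¹(w) y'` (twisted Weil duality),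
`twistedTorsionToH1 y' ∈ Sel_∞` (file XXIII + `δ2` + `δinf`), `2^{a+2b} y' = 0`
(`ZpExtensionGaloisTwistExponentProofs`), `y` strict at `v₀` and the twisted invariants of the dual small
(XXIV-a), so `H¹(ι^D) y = 0` (`ZpExtensionGaloisTwistLevelDualProofs`) and
`⟨H¹(ι) t'_v, y_v⟩_v = ⟨t'_v, loc_v H¹(ι^D) y⟩_v = 0` (`ZpExtensionGaloisTwistLevelProofs`) — Greenberg's
«`S'_{T^*}(F)` … hence `coker(γ')` is trivial» (p. 123) at finite level.

References: [GreenbergLNM1716] §4 pp. 107–109, 122–126; [MilneADT2006] I Thm. 2.6, Cor. 2.3, Thm. 4.10;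
[SilvermanAEC2009] III.8.1.
-/

set_option autoImplicit false
set_option linter.dupNamespace false

noncomputable section

open scoped Classical ContRepresentation

universe u

namespace Summit.BirchSwinnertonDyer.BirchSwinnertonDyer.Theorems.MultTransportTwistedDescent

open NumberField IsDedekindDomain Field WeierstrassCurve CategoryTheory
  Literature.NumberTheory.EllipticCurves Literature.NumberTheory.EllipticCurves.GreenbergVatsal2000
  Literature.NumberTheory.EllipticCurves.Greenberg1999
  Literature.NumberTheory.GaloisRepresentations Literature.NumberTheory.GaloisCohomology
  Summit.BirchSwinnertonDyer.BirchSwinnertonDyer.Theorems.MultTransportAtTwo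
open Literature.NumberTheory.GaloisRepresentations.DiscreteGaloisModule (localTatePairingZMod
  unramifiedSubgroup SelmerStructure TateDual)

variable (W : WeierstrassCurve ℚ) [W.IsElliptic] (κ : ZpExtension ℚ 2)

/-! ## §1 The engine: targets of level `j'` pushed to `J = j' + a + 2b`, orthogonal to `H¹_{𝓕^*_J}` -/

/-- **The orthogonality engine (one `u`, one `c`).** Fix the data of `LIFT₃` and an odd `u` equipped with:
`2^a` killing the `u`-eigenvectors of `conj_γ` in `Sel_{2^∞}(E/ℚ_∞)`, `2^b` killing `E(ℚ_∞)[2^∞]`, an omitted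
prime `v₀ ∈ S₀` with `σ₂ ∈ Γ_{ℚ_{v₀}}` and `2^f` killing the `u^{κ(σ₂)}`-eigenvectors of `σ₂` on every `E[2^J]`,
the two local dual Kummer statements `δ2`, `δinf`, and local targets at the places above `2` at some level `J_T`
for the class `c`. Then there are a level `J` and a target family `t` (supported at `2`, `∞`, hitting `loc c`)
orthogonal to `H¹_{𝓕^*}(ℚ, E[2^J](χ_u)^D)` for every family with the five printed properties — the conclusion
of `LIFT₃` for `(u, c)`. [cite: GreenbergLNM1716, §4 pp. 122–126] [cite: MilneADT2006, Ch. I, Thm. 4.10(b)] -/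
theorem exists_target_orthogonal_alt [W.IsGloballyMinimal] (hW : W.HasMultiplicativeReductionAtPrime 2)
    (hκ : κ.IsCyclotomic) {γ : absoluteGaloisGroup ℚ} (hγ : κ.IsTopGenerator γ)
    (S₀ : Finset (HeightOneSpectrum (𝓞 ℚ))) (hS₀ : ∀ v ∈ S₀, ((2 : ℕ) : 𝓞 ℚ) ∉ v.asIdeal)
    (hbad : ∀ v : HeightOneSpectrum (𝓞 ℚ), v ∉ S₀ → ((2 : ℕ) : 𝓞 ℚ) ∉ v.asIdeal → W.HasGoodReductionAt v)
    {u : ℤ} (hu : (2 : ℤ) ∣ u - 1)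
    {a : ℕ} (ha : ∀ s ∈ W.selmerInfty κ, W.conjH1 2 κ.kerSubgroup γ s = u • s → 2 ^ a • s = 0)
    {b : ℕ} (hb : ∀ P : W.geomPrimaryTorsion 2, (∀ h : κ.kerSubgroup, h • P = P) → 2 ^ b • P = 0)
    {v₀ : HeightOneSpectrum (𝓞 ℚ)} (hv₀ : v₀ ∈ S₀) (σ₂ : absoluteGaloisGroup (v₀.adicCompletion ℚ))
    {f : ℕ} (hf : ∀ (J : ℕ) (P : W.geomTorsion ((2 ^ J : ℕ) : ℤ)),
      absGaloisRestrict ℚ (v₀.adicCompletion ℚ) σ₂ • P =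
        (u ^ κ.twistExponent J (absGaloisRestrict ℚ (v₀.adicCompletion ℚ) σ₂)) • P → 2 ^ f • P = 0)
    (δ2 : ∀ (W : WeierstrassCurve ℚ) [W.IsElliptic] [W.IsGloballyMinimal],
      W.HasMultiplicativeReductionAtPrime 2 →
      ∀ (κ : ZpExtension ℚ 2) (_hκ : κ.IsCyclotomic) (J : ℕ) (u u' : ℤ) (hu : (2 : ℤ) ∣ u - 1)
        (hu' : (2 : ℤ) ∣ u' - 1) (huu' : ((2 : ℤ) ^ J) ∣ u * u' - 1)
        (e : W.geomTorsion ((2 ^ J : ℕ) : ℤ) → W.geomTorsion ((2 ^ J : ℕ) : ℤ) → AlgebraicClosure ℚ)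
        (hμ : ∀ S T, e S T ^ (2 ^ J) = 1)
        (hadd₁ : ∀ S₁ S₂ T, e (S₁ + S₂) T = e S₁ T * e S₂ T)
        (hadd₂ : ∀ S T₁ T₂, e S (T₁ + T₂) = e S T₁ * e S T₂)
        (hgal : ∀ (σ : absoluteGaloisGroup ℚ) (S T : W.geomTorsion ((2 ^ J : ℕ) : ℤ)),
          σ • e S T = e (σ • S) (σ • T))
        (_halt : ∀ T, e T T = 1) (_hnondeg : ∀ T, (∀ S, e S T = 1) → T = 0),
      ∀ [Finite (W.geomTorsion ((2 ^ J : ℕ) : ℤ))],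
      ∀ (v : HeightOneSpectrum (𝓞 ℚ)), ((2 : ℕ) : 𝓞 ℚ) ∈ v.asIdeal →
      ∀ (ιv : galoisCohomology ((DiscreteGaloisModule.mu ℚ (2 ^ J)).toLocal (Sum.inr v)) 2 →+ ZMod (2 ^ J)),
        Function.Bijective ιv →
      ∀ (y' : galoisCohomology
          ((W.twistedTorsionGaloisModule 2 κ J u' hu').restrictField (v.adicCompletion ℚ)) 1),
        (∀ a : galoisCohomology
            ((W.twistedTorsionGaloisModule 2 κ J u hu).restrictField (v.adicCompletion ℚ)) 1,
          W.twistedTorsionToLocalH1 2 κ J u hu (v.adicCompletion ℚ) a = 0 →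
          localTatePairingZMod (W.twistedTorsionGaloisModule 2 κ J u hu) (2 ^ J) (Sum.inr v) ιv a
            (galoisCohomology.map
              ((W.twistedWeilDual 2 κ J hu hu' huu' e hμ hadd₁ hadd₂ hgal).restrictField
                (v.adicCompletion ℚ)) 1 y') = 0) →
        W.twistedTorsionToLocalH1 2 κ J u' hu' (v.adicCompletion ℚ) y' = 0)
    (δinf : ∀ (W : WeierstrassCurve ℚ) [W.IsElliptic] [W.IsGloballyMinimal],
      W.HasMultiplicativeReductionAtPrime 2 →
      ∀ (κ : ZpExtension ℚ 2) (_hκ : κ.IsCyclotomic) (J : ℕ) (u u' : ℤ) (hu : (2 : ℤ) ∣ u - 1)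
        (hu' : (2 : ℤ) ∣ u' - 1) (huu' : ((2 : ℤ) ^ J) ∣ u * u' - 1)
        (e : W.geomTorsion ((2 ^ J : ℕ) : ℤ) → W.geomTorsion ((2 ^ J : ℕ) : ℤ) → AlgebraicClosure ℚ)
        (hμ : ∀ S T, e S T ^ (2 ^ J) = 1)
        (hadd₁ : ∀ S₁ S₂ T, e (S₁ + S₂) T = e S₁ T * e S₂ T)
        (hadd₂ : ∀ S T₁ T₂, e S (T₁ + T₂) = e S T₁ * e S T₂)
        (hgal : ∀ (σ : absoluteGaloisGroup ℚ) (S T : W.geomTorsion ((2 ^ J : ℕ) : ℤ)),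
          σ • e S T = e (σ • S) (σ • T))
        (_halt : ∀ T, e T T = 1) (_hnondeg : ∀ T, (∀ S, e S T = 1) → T = 0),
      ∀ [Finite (W.geomTorsion ((2 ^ J : ℕ) : ℤ))],
      ∀ (w : InfinitePlace ℚ)
        (ιw : galoisCohomology ((DiscreteGaloisModule.mu ℚ (2 ^ J)).toLocal (Sum.inl w)) 2 →+ ZMod (2 ^ J)),
        Function.Injective ιw →
      ∀ (y' : galoisCohomology ((W.twistedTorsionGaloisModule 2 κ J u' hu').restrictField w.Completion) 1),
        (∀ a : galoisCohomology ((W.twistedTorsionGaloisModule 2 κ J u hu).restrictField w.Completion) 1,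
          W.twistedTorsionToLocalH1 2 κ J u hu w.Completion a = 0 →
          localTatePairingZMod (W.twistedTorsionGaloisModule 2 κ J u hu) (2 ^ J) (Sum.inl w) ιw a
            (galoisCohomology.map
              ((W.twistedWeilDual 2 κ J hu hu' huu' e hμ hadd₁ hadd₂ hgal).restrictField w.Completion)
              1 y') = 0) →
        W.twistedTorsionToLocalH1 2 κ J u' hu' w.Completion y' = 0)
    (c : W.subgroupH1 2 κ.kerSubgroup) {JT : ℕ}
    (hT : ∀ v ∈ {v : HeightOneSpectrum (𝓞 ℚ) | ((2 : ℕ) : 𝓞 ℚ) ∈ v.asIdeal},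
      ∃ t : galoisCohomology ((W.twistedTorsionGaloisModule 2 κ JT u hu).restrictField (v.adicCompletion ℚ)) 1,
        W.twistedTorsionToLocalH1 2 κ JT u hu (v.adicCompletion ℚ) t =
          W.localResOver 2 κ.kerSubgroup (v.adicCompletion ℚ) c) :
        ∃ (J : ℕ)
          (t : Π v : Place ℚ,
            galoisCohomology ((W.twistedTorsionGaloisModule 2 κ J u hu).toLocal v) 1),
          (∀ v : HeightOneSpectrum (𝓞 ℚ), ((2 : ℕ) : 𝓞 ℚ) ∉ v.asIdeal → t (Sum.inr v) = 0) ∧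
          (∀ v ∈ {v : HeightOneSpectrum (𝓞 ℚ) | ((2 : ℕ) : 𝓞 ℚ) ∈ v.asIdeal},
            W.twistedTorsionToLocalH1 2 κ J u hu (v.adicCompletion ℚ) (t (Sum.inr v)) =
              W.localResOver 2 κ.kerSubgroup (v.adicCompletion ℚ) c) ∧
          (∀ w : InfinitePlace ℚ,
            W.twistedTorsionToLocalH1 2 κ J u hu w.Completion (t (Sum.inl w)) =
              W.localResOver 2 κ.kerSubgroup w.Completion c) ∧
          (∀ [Finite (W.geomTorsion ((2 ^ J : ℕ) : ℤ))] (inv : LocalInvariants ℚ (2 ^ J)),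
              inv.IsPerfect → inv.SumLocalTermEqZero → inv.UnramifiedOrthogonal → inv.SelmerComplement →
              inv.InjectiveAtRealPlaces →
            ∀ y ∈ (inv.dualSelmerStructure (W.twistedTorsionGaloisModule 2 κ J u hu)
                (W.twistedKummerSelmerStructure 2 S₀ κ J u hu)).selmerGroup,
              (∀ v : HeightOneSpectrum (𝓞 ℚ), ((2 : ℕ) : 𝓞 ℚ) ∈ v.asIdeal →
                localTatePairingZMod (W.twistedTorsionGaloisModule 2 κ J u hu) (2 ^ J) (Sum.inr v)
                  (inv (Sum.inr v)) (t (Sum.inr v))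
                  (galoisCohomology.localization
                    ((W.twistedTorsionGaloisModule 2 κ J u hu).tateDual (2 ^ J)) (Sum.inr v) 1 y) = 0) ∧
              (∀ w : InfinitePlace ℚ,
                localTatePairingZMod (W.twistedTorsionGaloisModule 2 κ J u hu) (2 ^ J) (Sum.inl w)
                  (inv (Sum.inl w)) (t (Sum.inl w))
                  (galoisCohomology.localization
                    ((W.twistedTorsionGaloisModule 2 κ J u hu).tateDual (2 ^ J)) (Sum.inl w) 1 y) =
                  0)) := by
  have hdiv : W.zsmul_geomPoints_surjective := zsmul_geomPoints_surjective_holds W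
  -- exponents and levels
  obtain ⟨jc, hjc⟩ := W.exists_pow_smul_subgroupH1_ker_eq_zero κ c
  set j' : ℕ := max (max (max JT jc) f) 1 with hj'
  have hJT : JT ≤ j' := (le_max_left _ _).trans ((le_max_left _ _).trans (le_max_left _ _))
  have hjcj : jc ≤ j' := (le_max_right _ _).trans ((le_max_left _ _).trans (le_max_left _ _))
  have hfj : f ≤ j' := (le_max_right _ _).trans (le_max_left _ _)
  have h1j : 1 ≤ j' := le_max_right _ _
  set ee : ℕ := a + b + b with hee
  set J : ℕ := j' + ee with hJdef
  have hjJ : j' ≤ J := Nat.le_add_right _ _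
  have hJsub : J - j' = ee := by omega
  have h1J : 1 ≤ J := h1j.trans hjJ
  -- `u'` inverse to `u` modulo `2^J`
  obtain ⟨u', hu', huu'⟩ := exists_odd_inverse_mod_two_pow hu J
  -- a Weil pairing at level `2^J`
  obtain ⟨e, hμ, hadd₁, hadd₂, halt, hnondeg, hgal⟩ := WeierstrassCurve.exists_weilPairing_holds W (2 ^ J)
    (by calc (2 : ℕ) = 2 ^ 1 := (pow_one 2).symm
      _ ≤ 2 ^ J := Nat.pow_le_pow_right (by norm_num) h1J)
    (by exact_mod_cast pow_ne_zero J (two_ne_zero))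
  haveI hFj : Finite (W.geomTorsion ((2 ^ j' : ℕ) : ℤ)) :=
    haveI : NeZero (2 ^ j') := ⟨pow_ne_zero _ two_ne_zero⟩; finite_geomTorsion_of_neZero W (2 ^ j')
  haveI hFJ : Finite (W.geomTorsion ((2 ^ J : ℕ) : ℤ)) :=
    haveI : NeZero (2 ^ J) := ⟨pow_ne_zero _ two_ne_zero⟩; finite_geomTorsion_of_neZero W (2 ^ J)
  -- `c` is killed by `2^{j'}`
  have hcj : 2 ^ j' • c = 0 := by
    obtain ⟨d, hd⟩ := Nat.exists_eq_add_of_le hjcj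
    rw [hd, pow_add, mul_comm, mul_smul, hjc, smul_zero]
  -- targets at level `j'`: at `2` (push `T2`'s target up), at `∞` (archimedean descent)
  have hT' : ∀ v : HeightOneSpectrum (𝓞 ℚ), ∃ t' : galoisCohomology
      ((W.twistedTorsionGaloisModule 2 κ j' u hu).restrictField (v.adicCompletion ℚ)) 1,
      ((2 : ℕ) : 𝓞 ℚ) ∈ v.asIdeal →
        W.twistedTorsionToLocalH1 2 κ j' u hu (v.adicCompletion ℚ) t' =
          W.localResOver 2 κ.kerSubgroup (v.adicCompletion ℚ) c := by
    intro v
    by_cases hv : ((2 : ℕ) : 𝓞 ℚ) ∈ v.asIdeal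
    · obtain ⟨t, ht⟩ := hT v hv
      refine ⟨galoisCohomology.map ((W.twistedTorsionIncl 2 κ hJT u hu).restrictField (v.adicCompletion ℚ)) 1 t,
        fun _ ↦ ?_⟩
      rw [W.twistedTorsionToLocalH1_map_incl 2 κ hJT u hu (v.adicCompletion ℚ) t, ht]
    · exact ⟨0, fun h ↦ absurd h hv⟩
  choose t₂ ht₂ using hT'
  have hTinf : ∀ w : InfinitePlace ℚ, ∃ t' : galoisCohomology
      ((W.twistedTorsionGaloisModule 2 κ j' u hu).restrictField w.Completion) 1,
      W.twistedTorsionToLocalH1 2 κ j' u hu w.Completion t' = W.localResOver 2 κ.kerSubgroup w.Completion c :=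
    fun w ↦ W.exists_twistedTorsionToLocalH1_eq_localResOver_infinitePlace 2 κ j' u hu hdiv w c hcj
  choose tinf htinf using hTinf
  -- the target family at level `J`
  let t : Π v : Place ℚ, galoisCohomology ((W.twistedTorsionGaloisModule 2 κ J u hu).toLocal v) 1 := fun v ↦
    match v with
    | Sum.inl w => galoisCohomology.map ((W.twistedTorsionIncl 2 κ hjJ u hu).restrictField w.Completion) 1 (tinf w)
    | Sum.inr v => if ((2 : ℕ) : 𝓞 ℚ) ∈ v.asIdeal then
        galoisCohomology.map ((W.twistedTorsionIncl 2 κ hjJ u hu).restrictField (v.adicCompletion ℚ)) 1 (t₂ v)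
        else 0
  have ht_inl : ∀ w, t (Sum.inl w) =
      galoisCohomology.map ((W.twistedTorsionIncl 2 κ hjJ u hu).restrictField w.Completion) 1 (tinf w) :=
    fun w ↦ rfl
  have ht_inr : ∀ v, ((2 : ℕ) : 𝓞 ℚ) ∈ v.asIdeal → t (Sum.inr v) =
      galoisCohomology.map ((W.twistedTorsionIncl 2 κ hjJ u hu).restrictField (v.adicCompletion ℚ)) 1 (t₂ v) :=
    fun v hv ↦ by
      change (if ((2 : ℕ) : 𝓞 ℚ) ∈ v.asIdeal then _ else _) = _
      rw [if_pos hv]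
  have ht_inr0 : ∀ v, ((2 : ℕ) : 𝓞 ℚ) ∉ v.asIdeal → t (Sum.inr v) = 0 := fun v hv ↦ by
    change (if ((2 : ℕ) : 𝓞 ℚ) ∈ v.asIdeal then _ else _) = _
    rw [if_neg hv]
  refine ⟨J, t, ht_inr0, fun v hv ↦ ?_, fun w ↦ ?_, ?_⟩
  · -- target at `2`
    rw [Set.mem_setOf_eq] at hv
    rw [ht_inr v hv, W.twistedTorsionToLocalH1_map_incl 2 κ hjJ u hu (v.adicCompletion ℚ) (t₂ v)]
    exact ht₂ v hv
  · -- target at `∞`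
    rw [ht_inl w, W.twistedTorsionToLocalH1_map_incl 2 κ hjJ u hu w.Completion (tinf w)]
    exact htinf w
  -- ORTHOGONALITY
  intro _instJ inv hperf hsum hUO hSC hreal y hy
  set wJ := W.twistedWeilDual 2 κ J hu hu' huu' e hμ hadd₁ hadd₂ hgal with hwJ
  -- read `y` in `E[2^J](χ_{u'})`
  set y' := galoisCohomology.map (W.twistedWeilDualInv 2 κ J hu hu' huu' e hμ hadd₁ hadd₂ hgal hnondeg) 1 y
    with hy'def
  have hyy' : galoisCohomology.map wJ 1 y' = y :=
    W.map_twistedWeilDual_map_inv 2 κ J hu hu' huu' e hμ hadd₁ hadd₂ hgal hnondeg y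
  have hy₁ : galoisCohomology.map wJ 1 y' ∈
      (inv.dualSelmerStructure (W.twistedTorsionGaloisModule 2 κ J u hu)
        (W.twistedKummerSelmerStructure 2 S₀ κ J u hu)).selmerGroup := by rw [hyy']; exact hy
  have hS : ∀ v : HeightOneSpectrum (𝓞 ℚ), (Sum.inr v : Place ℚ) ∉ twistedDescentPlaces (K := ℚ) 2 S₀ →
      ((2 ^ J : ℕ) : 𝓞 ℚ) ∉ v.asIdeal ∧
        GaloisRep.IsUnramifiedAt v (W.twistedTorsionGaloisModule 2 κ J u hu) := fun v hv ↦ by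
    rw [not_mem_twistedDescentPlaces_iff] at hv
    exact W.natCast_pow_not_mem_and_isUnramifiedAt_twistedTorsionGaloisModule 2 κ J u hu
      (S₀ := (↑S₀ : Set (HeightOneSpectrum (𝓞 ℚ)))) (fun v hv' hpv ↦ hbad v (by exact_mod_cast hv') hpv)
      (by exact_mod_cast hv.1) hv.2
  -- the local terms of `y` vanish on the kernels at `2` and `∞` (definition of `𝓕^*`)
  have hy_mem := hy
  rw [SelmerStructure.mem_selmerGroup_iff] at hy_mem
  have hker2 : ∀ v : HeightOneSpectrum (𝓞 ℚ), ((2 : ℕ) : 𝓞 ℚ) ∈ v.asIdeal →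
      ∀ a' : galoisCohomology ((W.twistedTorsionGaloisModule 2 κ J u hu).restrictField (v.adicCompletion ℚ)) 1,
        W.twistedTorsionToLocalH1 2 κ J u hu (v.adicCompletion ℚ) a' = 0 →
        localTatePairingZMod (W.twistedTorsionGaloisModule 2 κ J u hu) (2 ^ J) (Sum.inr v) (inv (Sum.inr v)) a'
          (galoisCohomology.map (wJ.restrictField (v.adicCompletion ℚ)) 1
            (galoisCohomology.res (W.twistedTorsionGaloisModule 2 κ J u' hu') (v.adicCompletion ℚ) 1 y')) = 0 := by
    intro v hv a' ha'
    have hvS : v ∉ S₀ := fun h ↦ hS₀ v h hv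
    have hyv := hy_mem (Sum.inr v)
    rw [LocalInvariants.dualSelmerStructure_apply,
      W.twistedKummerSelmerStructure_inr_of_mem_asIdeal 2 S₀ κ J u hu hvS hv,
      LocalInvariants.mem_dualLocalCondition_iff] at hyv
    rw [← W.res_map_twistedWeilDual 2 κ J hu hu' huu' e hμ hadd₁ hadd₂ hgal (v.adicCompletion ℚ) y', hyy']
    exact hyv a' ha'
  have hkerinf : ∀ w : InfinitePlace ℚ,
      ∀ a' : galoisCohomology ((W.twistedTorsionGaloisModule 2 κ J u hu).restrictField w.Completion) 1,
        W.twistedTorsionToLocalH1 2 κ J u hu w.Completion a' = 0 →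
        localTatePairingZMod (W.twistedTorsionGaloisModule 2 κ J u hu) (2 ^ J) (Sum.inl w) (inv (Sum.inl w)) a'
          (galoisCohomology.map (wJ.restrictField w.Completion) 1
            (galoisCohomology.res (W.twistedTorsionGaloisModule 2 κ J u' hu') w.Completion 1 y')) = 0 := by
    intro w a' ha'
    have hyw := hy_mem (Sum.inl w)
    rw [LocalInvariants.dualSelmerStructure_apply, W.twistedKummerSelmerStructure_inl 2 S₀ κ J u hu,
      LocalInvariants.mem_dualLocalCondition_iff] at hyw
    rw [← W.res_map_twistedWeilDual 2 κ J hu hu' huu' e hμ hadd₁ hadd₂ hgal w.Completion y', hyy']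
    exact hyw a' ha'
  -- dual-side control: `twistedTorsionToH1 y' ∈ Sel_∞`
  have hSel : W.twistedTorsionToH1 2 κ J u' hu' y' ∈ W.selmerInfty κ :=
    twistedTorsionToH1_mem_selmerInfty_of_mem_dualSelmer W 2 κ S₀ J hu hu' huu' e hμ hadd₁ hadd₂ hgal hnondeg
      hκ hS hperf hUO y' hy₁
      (fun v hv ↦ δ2 W hW κ hκ J u u' hu hu' huu' e hμ hadd₁ hadd₂ hgal halt hnondeg v hv (inv (Sum.inr v))
        (hperf v).1 _ (hker2 v hv))
      (fun w ↦ δinf W hW κ hκ J u u' hu hu' huu' e hμ hadd₁ hadd₂ hgal halt hnondeg w (inv (Sum.inl w))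
        (hreal.injective (NumberField.IsTotallyReal.isReal w)) _ (hkerinf w))
  -- hence `2^{a+2b} y' = 0` and `2^{J-j'} y = 0`
  have hey' : 2 ^ ee • y' = 0 :=
    W.pow_smul_eq_zero_of_twistedTorsionToH1_mem 2 κ J hu' huu' hγ hb (W.selmerInfty κ) ha y' hSel
  have hey : 2 ^ (J - j') • y = 0 := by
    rw [hJsub, ← hyy', ← map_nsmul, hey', map_zero]
  -- `y` is locally trivial at `v₀` and the twisted invariants of the dual at `v₀` are small
  have hloc : galoisCohomology.res ((W.twistedTorsionGaloisModule 2 κ J u hu).tateDual (2 ^ J))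
      (v₀.adicCompletion ℚ) 1 y = 0 :=
    localization_eq_zero_of_mem_dualSelmer W 2 κ S₀ J hu hperf hy hv₀
  have hinv : ∀ m : TateDual ℚ (W.geomTorsion ((2 ^ J : ℕ) : ℤ)) (2 ^ J),
      (∀ σ : absoluteGaloisGroup (v₀.adicCompletion ℚ),
        (W.twistedTorsionGaloisModule 2 κ J u hu).tateDual (2 ^ J)
          (absGaloisRestrict ℚ (v₀.adicCompletion ℚ) σ) m = m) →
      ((2 ^ f : ℕ) : ℤ) • m = 0 := fun m hm ↦
    pow_smul_tateDual_eq_zero_of_fixed W κ J hu hu' huu' e hμ hadd₁ hadd₂ hgal hnondeg σ₂ (hf J) m hm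
  -- so `H¹(ι^D) y = 0`
  have hιD : galoisCohomology.map (W.twistedTorsionInclDual 2 κ hjJ u hu) 1 y = 0 :=
    W.map_twistedTorsionInclDual_eq_zero_of_res_eq_zero 2 κ hjJ u hu hdiv hfj hinv y hey hloc
  -- the local terms: `⟨H¹(ι) t'_v, y_v⟩ = ⟨t'_v, loc_v H¹(ι^D) y⟩ = 0`
  refine ⟨fun v hv ↦ ?_, fun w ↦ ?_⟩
  · rw [ht_inr v hv]
    refine (W.localTatePairingZMod_map_twistedTorsionIncl 2 κ hjJ u hu (Sum.inr v) (inv (Sum.inr v))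
      (t₂ v) _).trans ?_
    have h0 : galoisCohomology.map ((W.twistedTorsionInclDual 2 κ hjJ u hu).restrictField
        (Place.Completion (K := ℚ) (Sum.inr v))) 1
        (galoisCohomology.localization ((W.twistedTorsionGaloisModule 2 κ J u hu).tateDual (2 ^ J))
          (Sum.inr v) 1 y) = 0 := by
      change galoisCohomology.map ((W.twistedTorsionInclDual 2 κ hjJ u hu).restrictField (v.adicCompletion ℚ)) 1
        (galoisCohomology.res ((W.twistedTorsionGaloisModule 2 κ J u hu).tateDual (2 ^ J))
          (v.adicCompletion ℚ) 1 y) = 0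
      rw [← galoisCohomology.res_map_one, hιD, map_zero]
    rw [h0]
    exact map_zero _
  · rw [ht_inl w]
    refine (W.localTatePairingZMod_map_twistedTorsionIncl 2 κ hjJ u hu (Sum.inl w) (inv (Sum.inl w))
      (tinf w) _).trans ?_
    have h0 : galoisCohomology.map ((W.twistedTorsionInclDual 2 κ hjJ u hu).restrictField
        (Place.Completion (K := ℚ) (Sum.inl w))) 1
        (galoisCohomology.localization ((W.twistedTorsionGaloisModule 2 κ J u hu).tateDual (2 ^ J))
          (Sum.inl w) 1 y) = 0 := by
      change galoisCohomology.map ((W.twistedTorsionInclDual 2 κ hjJ u hu).restrictField w.Completion) 1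
        (galoisCohomology.res ((W.twistedTorsionGaloisModule 2 κ J u hu).tateDual (2 ^ J)) w.Completion 1 y) = 0
      rw [← galoisCohomology.res_map_one, hιD, map_zero]
    rw [h0]
    exact map_zero _


end Summit.BirchSwinnertonDyer.BirchSwinnertonDyer.Theorems.MultTransportTwistedDescent

end
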